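import Literature.NumberTheory.Transcendental.NesterenkoEliminationChowForm
import Literature.NumberTheory.Transcendental.NesterenkoEliminationZeros
import Literature.NumberTheory.Transcendental.RoySmallValueEstimatesAbsHeightProofs
import Mathlib.NumberTheory.Height.MvPolynomial
import Mathlib.LinearAlgebra.Matrix.BilinearForm
import HarnessLib

/-!
# Stub plan `CycleAPIAt3`, P3 lemmas: the Chow form of a line is a Plücker form (towards `stub_satelliteHeightLine`)

Crux `stmt-Schanuel-6117` (`Summit.Schanuel.Schanuel.Theses.DiophantineDichotomy.ApproximationProperty`),
line `orbit-interpolation-determinant`, registered stub `CycleAPIAt3 : CycleAPIAt 3`; stub plan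
`Cruxes/ApproximationProperty/STUB-PLAN-CycleAPIAt3.md`, P3 (`SatelliteHeightLine`: the height of a
rational line carrying a long Galois orbit — file `…CycleAPIAt3SatelliteHeightLine.lean`, which
imports this one). Contents (all PROVED, no definitions):

* `SatelliteHeightLine.bilin_eq_of_vanish`, `SatelliteHeightLine.matrix_eq_wedge` — linear algebra:
  a bilinear form `B(x, y)` vanishing whenever `x, y ⊥ p` and whenever `x, y ⊥ q` (`p, q`
  independent) is `α (x·p)(y·q) + β (x·q)(y·p)`;
* `SatelliteHeightLine.eq_sum_of_bdeg_one`, `aeval_eq_sum_of_bdeg_one` — a form of `ℚ[u₁, u₂]`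
  all of whose monomials have degree `1` in each block is `∑ M_{ij} u_{1i} u_{2j}`;
* `SatelliteHeightLine.coeff_chowForm_swap`, `sum_coeff_chowForm_eq_zero` — for the Chow form `F`
  of index `2` of a homogeneous ideal with `deg = 1`: `M` is `±`-symmetric (symmetry of `F` in
  `u₁, u₂`) and `ᵗx M y = 0` when `x, y` vanish at a point of `V(I)` (Prop. 4.4: zeros of `F`);
* `SatelliteHeightLine.height_le_logHeight_coeff` — `h(F) ≤ h((M_{ij})_{ij})`;
* `logHeight_wedge_le` (registered sub-goal) — `h_L((qᵢpⱼ + c pᵢqⱼ)ᵢⱼ) ≤ h_L(p) + h_L(q) + κ [L:ℚ]`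
  for `c = ±1`, an absolute `κ` (Mathlib's `Height.logHeight_linearMap_apply_le` applied to the
  tensor `qᵢpⱼ`, `Height.logHeight_fun_mul_eq`).

Sources: NesterenkoPhilippon2001 (LNM 1752) Ch. 3 §4 (Prop. 4.4 and the remark after it, p. 38);
BombieriGubler2006 §1.5 (heights under base change), §2.8 (heights of Plücker coordinates); folklore
linear algebra.
-/

noncomputable section

-- `Summit.Schanuel.Schanuel.…` is the mandated summit/sub-problem namespace (single-conjunct summit), hence:
set_option linter.dupNamespace false

namespace Summit.Schanuel.Schanuel.Cruxes.ApproximationProperty.OrbitInterpolationDeterminant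

open Literature.NumberTheory.Transcendental.Nesterenko MvPolynomial
open scoped BigOperators

namespace SatelliteHeightLine

/-! ## Linear algebra: bilinear forms vanishing on `p^⊥ × p^⊥` and on `q^⊥ × q^⊥` -/

/-- If a bilinear form `B` vanishes on `ker ℓp × ker ℓp` and on `ker ℓq × ker ℓq`, and `a, a'` are
dual to `ℓp, ℓq`, then `B(x, y) = B(a, a') ℓp(x) ℓq(y) + B(a', a) ℓq(x) ℓp(y)`. [folklore] -/
theorem bilin_eq_of_vanish {F V : Type*} [Field F] [AddCommGroup V] [Module F V]
    (B : LinearMap.BilinForm F V) (ℓp ℓq : V →ₗ[F] F) (a a' : V)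
    (hap : ℓp a = 1) (haq : ℓq a = 0) (ha'p : ℓp a' = 0) (ha'q : ℓq a' = 1)
    (hp : ∀ x y, ℓp x = 0 → ℓp y = 0 → B x y = 0)
    (hq : ∀ x y, ℓq x = 0 → ℓq y = 0 → B x y = 0) (x y : V) :
    B x y = B a a' * (ℓp x * ℓq y) + B a' a * (ℓq x * ℓp y) := by
  have hx'p : ℓp (x - ℓp x • a - ℓq x • a') = 0 := by simp [hap, ha'p]
  have hx'q : ℓq (x - ℓp x • a - ℓq x • a') = 0 := by simp [haq, ha'q]
  have hy'p : ℓp (y - ℓp y • a - ℓq y • a') = 0 := by simp [hap, ha'p]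
  have hy'q : ℓq (y - ℓp y • a - ℓq y • a') = 0 := by simp [haq, ha'q]
  have h1 := hp _ _ hx'p hy'p
  have h2 := hq _ _ hx'q haq
  have h3 := hq _ _ haq hy'q
  have h4 := hq _ _ haq haq
  have h5 := hp _ _ hx'p ha'p
  have h6 := hp _ _ ha'p hy'p
  have h7 := hp _ _ ha'p ha'p
  simp only [LinearMap.BilinForm.sub_left, LinearMap.BilinForm.sub_right,
    LinearMap.BilinForm.smul_left, LinearMap.BilinForm.smul_right] at h1 h2 h3 h5 h6
  linear_combination h1 + ℓp y * h2 + ℓq y * h5 + ℓp x * h3 + ℓq x * h6 +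
    ℓp x * ℓp y * h4 + ℓq x * ℓq y * h7

/-- Matrix form: if `ᵗx M y = 0` whenever `x·p = y·p = 0` and whenever `x·q = y·q = 0`, and some
`2 × 2` minor of `(p, q)` is non-zero, then `M_{ij} = α pᵢ qⱼ + β qᵢ pⱼ`. [folklore] -/
theorem matrix_eq_wedge {F : Type*} [Field F] {n : Type*} [Fintype n] [DecidableEq n]
    (M : Matrix n n F) (p q : n → F) {i₀ j₀ : n} (hd : p i₀ * q j₀ - p j₀ * q i₀ ≠ 0)
    (hp : ∀ x y : n → F, ∑ k, x k * p k = 0 → ∑ k, y k * p k = 0 →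
      ∑ i, ∑ j, x i * M i j * y j = 0)
    (hq : ∀ x y : n → F, ∑ k, x k * q k = 0 → ∑ k, y k * q k = 0 →
      ∑ i, ∑ j, x i * M i j * y j = 0) :
    ∃ a a' : n → F, ∀ i j, M i j =
      Matrix.toBilin' M a a' * (p i * q j) + Matrix.toBilin' M a' a * (q i * p j) := by
  set d := p i₀ * q j₀ - p j₀ * q i₀ with hd_def
  let a : n → F := d⁻¹ • (q j₀ • Pi.single i₀ 1 - q i₀ • Pi.single j₀ 1)
  let a' : n → F := d⁻¹ • (p i₀ • Pi.single j₀ 1 - p j₀ • Pi.single i₀ 1)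
  have hB : ∀ x y : n → F, Matrix.toBilin' M x y = ∑ i, ∑ j, x i * M i j * y j :=
    Matrix.toBilin'_apply M
  have hℓ : ∀ (w x : n → F), Fintype.linearCombination F w x = ∑ k, x k * w k := fun w x => by
    simp [Fintype.linearCombination_apply]
  have key := bilin_eq_of_vanish (Matrix.toBilin' M) (Fintype.linearCombination F p)
    (Fintype.linearCombination F q) a a' ?_ ?_ ?_ ?_
    (fun x y hx hy => by rw [hB]; exact hp x y (by rw [← hℓ]; exact hx) (by rw [← hℓ]; exact hy))
    (fun x y hx hy => by rw [hB]; exact hq x y (by rw [← hℓ]; exact hx) (by rw [← hℓ]; exact hy))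
  · refine ⟨a, a', fun i j => ?_⟩
    have h := key (Pi.single i 1) (Pi.single j 1)
    simp only [Matrix.toBilin'_single, Fintype.linearCombination_apply_single, smul_eq_mul,
      one_mul] at h
    rw [h]
  · simp only [a, map_smul, map_sub, Fintype.linearCombination_apply_single, smul_eq_mul, one_mul]
    rw [show q j₀ * p i₀ - q i₀ * p j₀ = d by rw [hd_def]; ring, inv_mul_cancel₀ hd]
  · simp only [a, map_smul, map_sub, Fintype.linearCombination_apply_single, smul_eq_mul, one_mul]
    ring
  · simp only [a', map_smul, map_sub, Fintype.linearCombination_apply_single, smul_eq_mul, one_mul]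
    ring
  · simp only [a', map_smul, map_sub, Fintype.linearCombination_apply_single, smul_eq_mul, one_mul]
    rw [show p i₀ * q j₀ - p j₀ * q i₀ = d by rw [hd_def], inv_mul_cancel₀ hd]

/-- The `±`-symmetric case: if moreover `M_{ij} = c M_{ji}` then `M_{ij} = β (qᵢ pⱼ + c pᵢ qⱼ)`.
[folklore] -/
theorem matrix_eq_wedge_of_symm {F : Type*} [Field F] {n : Type*} [Fintype n] [DecidableEq n]
    (M : Matrix n n F) (p q : n → F) {c : F} (hsym : ∀ i j, M i j = c * M j i) {i₀ j₀ : n}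
    (hd : p i₀ * q j₀ - p j₀ * q i₀ ≠ 0)
    (hp : ∀ x y : n → F, ∑ k, x k * p k = 0 → ∑ k, y k * p k = 0 →
      ∑ i, ∑ j, x i * M i j * y j = 0)
    (hq : ∀ x y : n → F, ∑ k, x k * q k = 0 → ∑ k, y k * q k = 0 →
      ∑ i, ∑ j, x i * M i j * y j = 0) :
    ∃ β : F, ∀ i j, M i j = β * (q i * p j + c * (p i * q j)) := by
  obtain ⟨a, a', h⟩ := matrix_eq_wedge M p q hd hp hq
  have hB : Matrix.toBilin' M a a' = c * Matrix.toBilin' M a' a := by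
    simp only [Matrix.toBilin'_apply, Finset.mul_sum]
    rw [Finset.sum_comm]
    refine Finset.sum_congr rfl fun j _ => Finset.sum_congr rfl fun i _ => ?_
    rw [hsym i j]
    ring
  refine ⟨Matrix.toBilin' M a' a, fun i j => ?_⟩
  rw [h i j, hB]
  ring

/-- Two vectors with a non-vanishing `2 × 2` minor, from non-proportionality. [folklore] -/
theorem exists_minor_ne_zero {F : Type*} [Field F] {n : Type*} (p q : n → F) (hq : q ≠ 0)
    (h : ∀ l : F, p ≠ l • q) : ∃ i j, p i * q j - p j * q i ≠ 0 := by
  by_contra hall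
  push Not at hall
  obtain ⟨i, hi⟩ := Function.ne_iff.mp hq
  have hi' : q i ≠ 0 := by simpa using hi
  refine h (p i / q i) (funext fun j => ?_)
  have hij := hall i j
  rw [Pi.smul_apply, smul_eq_mul, div_mul_eq_mul_div, eq_div_iff hi']
  linear_combination -hij

/-! ## Forms of `ℚ[u₁, u₂]` of degree `1` in each block -/

variable {m : ℕ}

/-- A row of an exponent with block degree `1` is a single `1`. [folklore] -/
theorem exists_row_eq_single (γ : Fin 2 × Fin (m + 1) →₀ ℕ) (i : Fin 2) (h : bdeg i γ = 1) :
    ∃ a : Fin (m + 1), ∀ j, γ (i, j) = if j = a then 1 else 0 := by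
  classical
  set d : Fin (m + 1) →₀ ℕ := Finsupp.equivFunOnFinite.symm fun j => γ (i, j) with hd
  have hsum : d.sum (fun _ n => n) = 1 := by
    rw [Finsupp.sum_fintype _ _ (fun _ => rfl)]
    simpa [d, bdeg] using h
  obtain ⟨a, ha⟩ := (Finsupp.sum_eq_one_iff d).mp hsum
  refine ⟨a, fun j => ?_⟩
  have h1 : d j = γ (i, j) := rfl
  rw [← h1, ha, Finsupp.single_apply]
  simp [eq_comm]

/-- An exponent of block degrees `(1, 1)` is `u_{1i} u_{2j}`. [folklore] -/
theorem exists_eq_of_bdeg_one {γ : Fin 2 × Fin (m + 1) →₀ ℕ} (h0 : bdeg 0 γ = 1)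
    (h1 : bdeg 1 γ = 1) :
    ∃ i j : Fin (m + 1), γ = Finsupp.single (0, i) 1 + Finsupp.single (1, j) 1 := by
  classical
  obtain ⟨i, hi⟩ := exists_row_eq_single γ 0 h0
  obtain ⟨j, hj⟩ := exists_row_eq_single γ 1 h1
  refine ⟨i, j, Finsupp.ext fun ⟨k, l⟩ => ?_⟩
  fin_cases k
  · simp only [Fin.zero_eta, Fin.isValue, Finsupp.coe_add, Pi.add_apply, Finsupp.single_apply,
      Prod.mk.injEq, true_and, hi l]
    simp [eq_comm]
  · simp only [Fin.mk_one, Fin.isValue, Finsupp.coe_add, Pi.add_apply, Finsupp.single_apply,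
      Prod.mk.injEq, true_and, hj l]
    simp [eq_comm]

/-- The exponents `u_{1i} u_{2j}` are pairwise distinct. [folklore] -/
theorem single_add_single_inj {i j i' j' : Fin (m + 1)}
    (h : (Finsupp.single (0, i) 1 + Finsupp.single (1, j) 1 : Fin 2 × Fin (m + 1) →₀ ℕ) =
      Finsupp.single (0, i') 1 + Finsupp.single (1, j') 1) : i = i' ∧ j = j' := by
  classical
  have hi := DFunLike.congr_fun h (0, i')
  have hj := DFunLike.congr_fun h (1, j')
  simp only [Fin.isValue, Finsupp.coe_add, Pi.add_apply, Finsupp.single_apply, Prod.mk.injEq,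
    true_and, zero_ne_one, false_and, if_false, add_zero, if_true, one_ne_zero, zero_add] at hi hj
  exact ⟨by by_contra h'; simp [h'] at hi, by by_contra h'; simp [h'] at hj⟩

/-- **A form of `ℚ[u₁, u₂]` of degree `1` in each block of variables is
`∑_{i,j} M_{ij} u_{1i} u_{2j}`** with `M_{ij}` its coefficient of `u_{1i} u_{2j}`. [folklore] -/
theorem eq_sum_of_bdeg_one (F : RU 2 m) (hF : ∀ γ ∈ F.support, bdeg 0 γ = 1 ∧ bdeg 1 γ = 1) :
    F = ∑ i : Fin (m + 1), ∑ j : Fin (m + 1),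
      C (coeff (Finsupp.single (0, i) 1 + Finsupp.single (1, j) 1) F) * (X (0, i) * X (1, j)) := by
  classical
  refine MvPolynomial.ext _ _ fun γ => ?_
  have hXX : ∀ i j : Fin (m + 1), (X (0, i) * X (1, j) : RU 2 m) =
      monomial (Finsupp.single (0, i) 1 + Finsupp.single (1, j) 1) 1 := fun i j => by
    rw [X, X, monomial_mul, mul_one]
  simp only [coeff_sum, coeff_C_mul, hXX, coeff_monomial, mul_ite, mul_one, mul_zero]
  by_cases hγ : γ ∈ F.support
  · obtain ⟨i₀, j₀, rfl⟩ := exists_eq_of_bdeg_one (hF γ hγ).1 (hF γ hγ).2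
    rw [Finset.sum_eq_single i₀ (fun i _ hi => Finset.sum_eq_zero fun j _ => if_neg fun h =>
      hi (single_add_single_inj h).1) (fun h => absurd (Finset.mem_univ _) h),
      Finset.sum_eq_single j₀ (fun j _ hj => if_neg fun h => hj (single_add_single_inj h).2)
      (fun h => absurd (Finset.mem_univ _) h), if_pos rfl]
  · rw [notMem_support_iff.mp hγ]
    symm
    refine Finset.sum_eq_zero fun i _ => Finset.sum_eq_zero fun j _ => ?_
    split_ifs with h
    · rw [h]; exact notMem_support_iff.mp hγ
    · rfl

/-- Hence its value at `u` is the bilinear form `∑ M_{ij} u_{1i} u_{2j}`. [folklore] -/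
theorem aeval_eq_sum_of_bdeg_one (F : RU 2 m) (hF : ∀ γ ∈ F.support, bdeg 0 γ = 1 ∧ bdeg 1 γ = 1)
    {A : Type*} [CommRing A] [Algebra ℚ A] (u : Fin 2 × Fin (m + 1) → A) :
    aeval u F = ∑ i : Fin (m + 1), ∑ j : Fin (m + 1),
      algebraMap ℚ A (coeff (Finsupp.single (0, i) 1 + Finsupp.single (1, j) 1) F) *
        (u (0, i) * u (1, j)) := by
  conv_lhs => rw [eq_sum_of_bdeg_one F hF]
  simp only [map_sum, map_mul, algHom_C, aeval_X]


/-! ## The Chow form of index `2` of an ideal of degree `1` -/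

variable {I : Ideal (Rx m)}

/-- The associated form of index `2` of an ideal with `deg I = 1` has degree `1` in each block
`u₁`, `u₂`. [cite: NesterenkoPhilippon2001, Ch. 3, remark after Prop. 4.4 (p. 38)] -/
theorem bdeg_chowForm_eq_one (hdeg : ideg I 2 = 1) :
    ∀ γ ∈ (chowForm I 2).support, bdeg 0 γ = 1 ∧ bdeg 1 γ = 1 := fun _ hγ =>
  ⟨(bdeg_eq_ideg_of_mem_support_chowForm I two_pos hγ 0).trans hdeg,
    (bdeg_eq_ideg_of_mem_support_chowForm I two_pos hγ 1).trans hdeg⟩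

/-- **Symmetry of the associated form in `u₁, u₂`** at the level of the coefficient matrix of a
form of degree `1`: `M_{ij} = c M_{ji}` with `c = ±1` (the swap `u₁ ↔ u₂` preserves `Ī(2) = (F)`,
so `F(u₂, u₁) = c F(u₁, u₂)`, and swapping twice gives `c² = 1`).
[cite: NesterenkoPhilippon2001, Ch. 3, remark after Prop. 4.4 (p. 38)] -/
theorem coeff_chowForm_swap (hpr : (elimIdeal I 2).IsPrincipal) (hF0 : chowForm I 2 ≠ 0) :
    ∃ c : ℚ, (c = 1 ∨ c = -1) ∧ ∀ i j : Fin (m + 1),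
      coeff (Finsupp.single (0, i) 1 + Finsupp.single (1, j) 1) (chowForm I 2) =
        c * coeff (Finsupp.single (0, j) 1 + Finsupp.single (1, i) 1) (chowForm I 2) := by
  classical
  set σ : Equiv.Perm (Fin 2) := Equiv.swap 0 1 with hσ_def
  have hinv : ∀ G, swapU 2 m σ (swapU 2 m σ G) = G := fun G => by
    have h := swapU_swapU_symm 2 m σ G
    rwa [hσ_def, Equiv.symm_swap] at h
  obtain ⟨c, -, hcF⟩ := exists_eq_C_mul_chowForm I 2 (swapU 2 m σ) (swapU 2 m σ)
    (fun G hG => swapU_mem_elimIdeal I 2 σ hG) (fun G hG => swapU_mem_elimIdeal I 2 σ hG) hinv hpr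
  have hcc : c * c = 1 := by
    have hC : swapU 2 m σ (C c) = C c := by rw [swapU, rename_C]
    have h := hinv (chowForm I 2)
    rw [hcF, map_mul, hC, hcF, ← mul_assoc, ← C_mul] at h
    have h2 : C (c * c - 1) * chowForm I 2 = 0 := by
      rw [map_sub, C_1, sub_mul, one_mul, h, sub_self]
    rcases mul_eq_zero.mp h2 with h3 | h3
    · exact sub_eq_zero.mp ((C_eq_zero).mp h3)
    · exact absurd h3 hF0
  refine ⟨c, mul_self_eq_one_iff.mp hcc, fun i j => ?_⟩
  have hinj : Function.Injective (Prod.map σ id : Fin 2 × Fin (m + 1) → Fin 2 × Fin (m + 1)) :=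
    (σ.prodCongr (Equiv.refl _)).injective
  have h := coeff_rename_mapDomain (Prod.map σ id) hinj (chowForm I 2)
    (Finsupp.single (0, j) 1 + Finsupp.single (1, i) 1)
  have hmd : Finsupp.mapDomain (Prod.map σ id)
      (Finsupp.single ((0 : Fin 2), j) 1 + Finsupp.single ((1 : Fin 2), i) 1) =
      Finsupp.single ((0 : Fin 2), i) 1 + Finsupp.single ((1 : Fin 2), j) 1 := by
    rw [Finsupp.mapDomain_add, Finsupp.mapDomain_single, Finsupp.mapDomain_single,
      add_comm (Finsupp.single _ _)]
    simp [σ]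
  rw [hmd] at h
  change coeff _ (swapU 2 m σ (chowForm I 2)) = _ at h
  rw [hcF, coeff_C_mul] at h
  rw [← h, ← mul_assoc, hcc, one_mul]

/-- **Zeros of the associated form, bilinear reading** (Prop. 4.4: `F(u₁, u₂) = 0` when the
hyperplanes `u₁, u₂` pass through a point `β̄ ∈ V(I)`): for `deg I = 1`,
`∑ M_{ij} xᵢ yⱼ = 0` whenever `x·β̄ = y·β̄ = 0`. [cite: NesterenkoPhilippon2001, Ch. 3 Prop. 4.4 (p. 38)] -/
theorem sum_coeff_chowForm_eq_zero
    (hI : letI := MvPolynomial.gradedAlgebra (σ := Fin (m + 1)) (R := ℚ)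
      I.IsHomogeneous (homogeneousSubmodule (Fin (m + 1)) ℚ))
    (hpr : (elimIdeal I 2).IsPrincipal) (hdeg : ideg I 2 = 1) {β : Fin (m + 1) → ℂ}
    (hβ : β ∈ projZeros I) {x y : Fin (m + 1) → ℂ} (hx : ∑ k, x k * β k = 0)
    (hy : ∑ k, y k * β k = 0) :
    ∑ i : Fin (m + 1), ∑ j : Fin (m + 1),
      algebraMap ℚ ℂ (coeff (Finsupp.single (0, i) 1 + Finsupp.single (1, j) 1) (chowForm I 2)) *
        (x i * y j) = 0 := by
  set u : Fin 2 × Fin (m + 1) → ℂ := fun v => (![x, y] : Fin 2 → Fin (m + 1) → ℂ) v.1 v.2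
    with hu_def
  have hu : aeval u (chowForm I 2) = 0 := by
    refine (aeval_chowForm_eq_zero_iff hI hpr u).mpr ⟨β, hβ, fun i => ?_⟩
    fin_cases i
    · simpa [u] using hx
    · simpa [u] using hy
  rw [aeval_eq_sum_of_bdeg_one _ (bdeg_chowForm_eq_one hdeg) u] at hu
  simpa [u] using hu

/-! ## Heights -/

/-- `h(F) ≤ h((M_{ij})_{i,j})`: the coefficients of `F` are among the `M_{ij}` (the other `M_{ij}`
vanish). [cite: NesterenkoPhilippon2001, Ch. 3 Def. 4.2 (p. 38)] -/
theorem height_le_logHeight_coeff (F : RU 2 m) (hF : ∀ γ ∈ F.support, bdeg 0 γ = 1 ∧ bdeg 1 γ = 1) :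
    height F ≤ Height.logHeight (fun ij : Fin (m + 1) × Fin (m + 1) =>
      coeff (Finsupp.single (0, ij.1) 1 + Finsupp.single (1, ij.2) 1) F) := by
  classical
  have hf : ∀ γ : F.support, ∃ ij : Fin (m + 1) × Fin (m + 1),
      Finsupp.single (0, ij.1) 1 + Finsupp.single (1, ij.2) 1 = (γ : Fin 2 × Fin (m + 1) →₀ ℕ) :=
    fun γ => by
      obtain ⟨i, j, h⟩ := exists_eq_of_bdeg_one (hF γ γ.2).1 (hF γ γ.2).2
      exact ⟨(i, j), h.symm⟩
  choose f hf using hf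
  have heq : (fun γ : F.support => coeff (γ : Fin 2 × Fin (m + 1) →₀ ℕ) F) =
      (fun ij : Fin (m + 1) × Fin (m + 1) =>
        coeff (Finsupp.single (0, ij.1) 1 + Finsupp.single (1, ij.2) 1) F) ∘ f :=
    funext fun γ => by simp only [Function.comp_apply, hf γ]
  unfold height
  rw [heq]
  exact Height.logHeight_comp_le f _

end SatelliteHeightLine

/-- **Registered sub-goal `logHeight_wedge_le`** (aux for `stub_satelliteHeightLine`): the height of
the `±`-symmetrised tensor of two vectors, `h_L((qᵢ pⱼ + c pᵢ qⱼ)_{i,j}) ≤ h_L(p) + h_L(q) + κ [L:ℚ]`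
for `c = ±1` with an absolute constant `κ = κ(n)` (it is the image of the tensor `(qᵢ pⱼ)`, of
height `h(q) + h(p)`, under a fixed integer linear map; Mathlib's
`Height.logHeight_linearMap_apply_le`, `Height.logHeight_fun_mul_eq`, and `h_L = [L:ℚ] h_ℚ` on
rational tuples). [cite: BombieriGubler2006, §1.5 (Lemma 1.5.2) and §2.8 (p. 80)] -/
theorem logHeight_wedge_le : ∀ n : ℕ, ∃ κ : ℝ, ∀ (L : Type) [Field L] [NumberField L] (p q : Fin n → L) (c : L), (c = 1 ∨ c = -1) → Height.logHeight (fun ij : Fin n × Fin n => q ij.1 * p ij.2 + c * (p ij.1 * q ij.2)) ≤ Height.logHeight p + Height.logHeight q + κ * Module.finrank ℚ L := by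
  intro n
  classical
  set A : ℚ → (Fin n × Fin n) × (Fin n × Fin n) → ℚ := fun c w =>
    (if w.2 = w.1 then 1 else 0) + (if w.2 = w.1.swap then c else 0) with hA_def
  refine ⟨Real.log (Nat.card (Fin n × Fin n)) +
    max (Height.logHeight (A 1)) (Height.logHeight (A (-1))), ?_⟩
  intro L _ _ p q c hc
  obtain ⟨c', hc', rfl⟩ : ∃ c' : ℚ, (c' = 1 ∨ c' = -1) ∧ (c' : L) = c := by
    rcases hc with rfl | rfl
    exacts [⟨1, Or.inl rfl, by simp⟩, ⟨-1, Or.inr rfl, by simp⟩]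
  set T : Fin n × Fin n → L := fun kl => q kl.1 * p kl.2 with hT_def
  set AL : (Fin n × Fin n) × (Fin n × Fin n) → L := fun w => algebraMap ℚ L (A c' w) with hAL_def
  have hS : (fun ij : Fin n × Fin n => q ij.1 * p ij.2 + (c' : L) * (p ij.1 * q ij.2)) =
      fun ij => ∑ kl, AL (ij, kl) * T kl := by
    funext ij
    simp only [AL, A, T, map_add, apply_ite (algebraMap ℚ L), map_one, map_zero, eq_ratCast,
      add_mul, ite_mul, one_mul, zero_mul, Finset.sum_add_distrib, Finset.sum_ite_eq',
      Finset.mem_univ, if_true, Prod.fst_swap, Prod.snd_swap]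
    ring
  have h1 := Height.logHeight_linearMap_apply_le AL T
  have hT : Height.logHeight T ≤ Height.logHeight q + Height.logHeight p := by
    by_cases hq : q = 0
    · have : T = 0 := funext fun kl => by simp [T, hq]
      rw [this, Height.logHeight_zero]
      positivity
    by_cases hp : p = 0
    · have : T = 0 := funext fun kl => by simp [T, hp]
      rw [this, Height.logHeight_zero]
      positivity
    exact (Height.logHeight_fun_mul_eq hq hp).le
  have hfin : (0 : ℝ) < Module.finrank ℚ L := by exact_mod_cast Module.finrank_pos
  have hAL : Height.logHeight AL = Module.finrank ℚ L * Height.logHeight (A c') := by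
    have h := Literature.NumberTheory.Transcendental.NguyenRoy.logHeight_comp_div_finrank
      (algebraMap ℚ L) (A c')
    rw [Module.finrank_self, Nat.cast_one, div_one, div_eq_iff hfin.ne'] at h
    rw [mul_comm]
    exact h
  have hA : Height.logHeight (A c') ≤ max (Height.logHeight (A 1)) (Height.logHeight (A (-1))) := by
    rcases hc' with rfl | rfl
    exacts [le_max_left _ _, le_max_right _ _]
  have htw : (Height.totalWeight L : ℝ) = Module.finrank ℚ L := by
    exact_mod_cast NumberField.totalWeight_eq_finrank L
  have hmul := mul_le_mul_of_nonneg_left hA hfin.le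
  rw [hS]
  refine h1.trans ?_
  rw [htw, hAL]
  nlinarith [hmul, hT]

end Summit.Schanuel.Schanuel.Cruxes.ApproximationProperty.OrbitInterpolationDeterminant

end
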